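import Summits.QuantumFields.YangMills.Theorems.UnitScaleTiltProp8LinAvgFluxExact
import HarnessLib

/-!
# Route `UnitScaleTilt`, crux K1 «MinimiserStabilityRegPr» (stmt-QuantumFields-19200) — route-R E′ (A′)-comb, COMB-FLAT-COERCIVITY sub-lemma (I3′) «δQ-SLICE», FILE F-c-2 (ii):
# **WALK STOKES — translating a lattice walk sideways changes its signed sum by two connectors minus the swept ribbon**, the ribbon being the signed sum, ALONG THE SAME
# WALK, of the unit plaquette circulations; iterated along a word: connectors minus the swept surface (a signed sum over the translating word of ribbons)

Cell `ym3-torus`, width seat `ym-ust-19200-w4` (gen 8; (I3′) LOCATE-first taker, RULING №18 (2)).  THEOREMS ONLY (0 `def`, 0 `sorry`); `--supports stmt-QuantumFields-19200`,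
count-neutral.  YM₃ on T³ is a ladder rung (R3), not the Clay problem; nothing here claims (I3′), COMB-FLAT-COERCIVITY, `norm_G₀ᶜ`, hcoS, E′, EX, the crux, d = 4 or the mass gap.

WHY.  The filling certificate of record for `δQ` (this seat's LOCATE v2 `LOCATE-I3-FILLING-w4g8.md` d592d91c, §2–§3) is assembled from ONE move: slide a lattice walk `Γ` (a stair
word of `Λ_k`'s `combMean`, lit `BlockAveragingEMLLinearised.combMean`∕`walkSum`∕`walk`; a comb word of `r₁`'s `Fhat`) sideways along another word `u` (a connector); abelian
Stokes says `Y(Γ + u) − Y(Γ) = (Y(u from Γ's end) − Y(u from Γ's start)) − ⟨swept surface, dY⟩`.  F-c-1 (`…Prop7TranslatedTubeFilling`) is the case `Γ` = a straight segment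
(✓`rect_stokes`); this file is the general walk, in the `walk`∕`walkSum`∕`walkEnd` letters of lit `T4Continuum`∕`BlockAveragingEMLLinearised`, DEF-FREE: the ribbon swept by
the unit translation `e_κ` is `walkSum` of the bond function `b ↦ Y⟨b₋, dir b⟩ + Y⟨b₋ + e_{dir b}, κ⟩ − Y⟨b₋ + e_κ, dir b⟩ − Y⟨b₋, κ⟩` (the unit plaquette circulation at `(b₋; dir b, κ)`)
along the SAME walk — forward steps count `+`, backward steps `−`, exactly as `walkSum` signs them — and the surface swept along a word `u` is the `walkSum` along `walk x u` of
the bond function `t ↦ (ribbon of Γ based at t₋ in direction dir t)`.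

WHAT IS PROVED (ns `…Theorems.Prop7WalkStokes`; any `[AddCommGroup V]`, any torus `Site P j`):
* §1 `unshift_shift_comm'`, ★`walkEnd_shift`, `walkEnd_unshift` (translation covariance of the end site);
* §2 ★★★`walkSum_shift_sub` — UNIT WALK STOKES: `Y(walk (x+e_κ) w) − Y(walk x w) = (Y⟨walkEnd x w, κ⟩ − Y⟨x, κ⟩) − walkSum (plaquette field_κ of Y) (walk x w)`;
* §3 ★★★`walkSum_walkEnd_sub` — WORD WALK STOKES: `Y(walk (walkEnd x u) w) − Y(walk x w) = (Y(walk (walkEnd x w) u) − Y(walk x u)) − walkSum (t ↦ ribbon_{dir t}(t₋, w)) (walk x u)`,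
  and `walkSum_walkEnd_sub_of_closed` (closed `w`, `walkEnd x w = x`: the connectors cancel, only the swept surface remains);
* §4 `plaqField_eq_curl_of_lt` ∕ `plaqField_eq_neg_curl_of_gt` ∕ `plaqField_self` — the plaquette field in the route's `curl 1 Y` letters with its orientation sign
  (`[Module ℝ V]`).
HONEST SCOPE: identities of finite signed sums (abelian, linear `Y`); no estimate; nothing of `Λ_k`, `r₁`, `τ` or the counts; (I3′)∕COMB-FLAT-COERCIVITY∕A6ᶜ OPEN.
Rung R3, not Clay; YM gap NOT proved.

References: T. Bałaban, CMP 95 (1984) 17–40 [Balaban1984PropagatorsI] ((1.2) p.18, (1.8)–(1.9) p.19: contour sums and the plaquette identity); CMP 98 (1985) 17–51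
[Balaban1985Averaging] ((62) p.28, (124) p.36: the stair∕comb words this serves); CMP 99 (1985) 389–434 [Balaban1985BackgroundPropagators] (Thm 3.11 p.416: the row served).
-/

noncomputable section

open scoped BigOperators

namespace Summit.QuantumFields.YangMills.Theorems.Prop7WalkStokes

open Literature.MathematicalPhysics.QuantumFieldTheory.Balaban1983to89
open T4Continuum BlockAveraging BlockAveragingEMLLinearised LatticeFieldCalculus
open BlockAveragingEMLProp2 (shift_shift_comm)

variable {P : Params} {j : ℕ} {V : Type*} [AddCommGroup V]

/-! ## §1 Torus sites: shifts, unshifts, and the end site of a translated walk -/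

/-- `(x + e_κ) − e_μ = (x − e_μ) + e_κ`. [cite: Balaban1987RG1, (0.1) p.251] -/
theorem unshift_shift_comm' (x : Site P j) (μ κ : Fin P.d) : (x.shift κ).unshift μ = (x.unshift μ).shift κ := by
  have h : ((x.unshift μ).shift κ).shift μ = x.shift κ := by
    rw [shift_shift_comm, Site.shift_unshift]
  rw [← h, Site.unshift_shift]

/-- ★ The end site of a translated walk is the translated end site: `walkEnd (x + e_κ) w = walkEnd x w + e_κ`. [cite: Balaban1987RG1, (0.3) p.252] -/
theorem walkEnd_shift (κ : Fin P.d) : ∀ (x : Site P j) (w : List (Letter P.d)), walkEnd (x.shift κ) w = (walkEnd x w).shift κ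
  | _, [] => rfl
  | x, (μ, true) :: w => by
    rw [walkEnd, walkEnd, shift_shift_comm, walkEnd_shift κ (x.shift μ) w]
  | x, (μ, false) :: w => by
    rw [walkEnd, walkEnd, unshift_shift_comm', walkEnd_shift κ (x.unshift μ) w]

/-- `walkEnd (x − e_κ) w = walkEnd x w − e_κ`. [cite: Balaban1987RG1, (0.3) p.252] -/
theorem walkEnd_unshift (κ : Fin P.d) (x : Site P j) (w : List (Letter P.d)) : walkEnd (x.unshift κ) w = (walkEnd x w).unshift κ := by
  have h := walkEnd_shift κ (x.unshift κ) w
  rw [Site.shift_unshift] at h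
  rw [h, Site.unshift_shift]

/-! ## §2 Unit walk Stokes: sliding a walk by `e_κ` -/

/-- ★★★ **UNIT WALK STOKES.**  For every bond field `Y`, direction `κ`, start `x` and word `w`:
`Y(walk (x + e_κ) w) − Y(walk x w) = (Y⟨walkEnd x w, κ⟩ − Y⟨x, κ⟩) − walkSum (b ↦ Y⟨b₋, dir b⟩ + Y⟨b₋ + e_{dir b}, κ⟩ − Y⟨b₋ + e_κ, dir b⟩ − Y⟨b₋, κ⟩) (walk x w)` — the translated
walk is the original plus the connector at the end minus the connector at the start, minus the RIBBON of unit plaquette circulations swept, summed along the same walk with the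
walk's own signs (abelian Stokes, one plaquette per step). [cite: Balaban1984PropagatorsI, (1.9) p.19] -/
theorem walkSum_shift_sub (Y : PBond P j → V) (κ : Fin P.d) : ∀ (x : Site P j) (w : List (Letter P.d)),
    walkSum Y (walk (x.shift κ) w) - walkSum Y (walk x w)
      = (Y ⟨walkEnd x w, κ⟩ - Y ⟨x, κ⟩)
        - walkSum (fun b : PBond P j => Y ⟨b.src, b.dir⟩ + Y ⟨b.src.shift b.dir, κ⟩ - Y ⟨b.src.shift κ, b.dir⟩ - Y ⟨b.src, κ⟩) (walk x w)
  | x, [] => by simp [walk, walkEnd]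
  | x, (μ, true) :: w => by
    have ih := walkSum_shift_sub Y κ (x.shift μ) w
    simp only [walk, walkEnd, walkSum_cons, if_true]
    rw [shift_shift_comm x κ μ]
    -- `LHS = (Y⟨x+e_κ,μ⟩ − Y⟨x,μ⟩) + (translated tail − tail)`
    have e : Y ⟨x.shift κ, μ⟩ + walkSum Y (walk ((x.shift μ).shift κ) w) - (Y ⟨x, μ⟩ + walkSum Y (walk (x.shift μ) w))
        = (Y ⟨x.shift κ, μ⟩ - Y ⟨x, μ⟩) + (walkSum Y (walk ((x.shift μ).shift κ) w) - walkSum Y (walk (x.shift μ) w)) := by abel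
    rw [e, ih]
    abel
  | x, (μ, false) :: w => by
    have ih := walkSum_shift_sub Y κ (x.unshift μ) w
    simp only [walk, walkEnd, walkSum_cons, Bool.false_eq_true, if_false]
    rw [unshift_shift_comm' x μ κ]
    have e : -Y ⟨(x.unshift μ).shift κ, μ⟩ + walkSum Y (walk ((x.unshift μ).shift κ) w) - (-Y ⟨x.unshift μ, μ⟩ + walkSum Y (walk (x.unshift μ) w))
        = -(Y ⟨(x.unshift μ).shift κ, μ⟩ - Y ⟨x.unshift μ, μ⟩) + (walkSum Y (walk ((x.unshift μ).shift κ) w) - walkSum Y (walk (x.unshift μ) w)) := by abel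
    rw [e, ih, Site.shift_unshift]
    abel

/-! ## §3 Word walk Stokes: sliding a walk along a word -/

/-- ★★★ **WORD WALK STOKES.**  Sliding the walk of `w` from `x` to `walkEnd x u` along the word `u`:
`Y(walk (walkEnd x u) w) − Y(walk x w) = (Y(walk (walkEnd x w) u) − Y(walk x u)) − walkSum (t ↦ walkSum (plaquette field_{dir t} of Y) (walk t₋ w)) (walk x u)` — connector at
the end minus connector at the start, minus the SWEPT SURFACE: the signed sum over the steps `t` of `u` (forward `+`, backward `−`) of the ribbons of `w` based at `t₋`.
[cite: Balaban1984PropagatorsI, (1.9) p.19; Balaban1985Averaging, (62) p.28] -/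
theorem walkSum_walkEnd_sub (Y : PBond P j → V) (w : List (Letter P.d)) : ∀ (x : Site P j) (u : List (Letter P.d)),
    walkSum Y (walk (walkEnd x u) w) - walkSum Y (walk x w)
      = (walkSum Y (walk (walkEnd x w) u) - walkSum Y (walk x u))
        - walkSum (fun t : PBond P j =>
            walkSum (fun b : PBond P j => Y ⟨b.src, b.dir⟩ + Y ⟨b.src.shift b.dir, t.dir⟩ - Y ⟨b.src.shift t.dir, b.dir⟩ - Y ⟨b.src, t.dir⟩) (walk t.src w))
          (walk x u)
  | x, [] => by simp [walk, walkEnd]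
  | x, (κ, true) :: u => by
    have ih := walkSum_walkEnd_sub Y w (x.shift κ) u
    have h1 := walkSum_shift_sub Y κ x w
    simp only [walk, walkEnd, walkSum_cons, if_true]
    rw [walkEnd_shift κ x w] at ih
    -- telescope through the intermediate start `x + e_κ`
    have e : walkSum Y (walk (walkEnd (x.shift κ) u) w) - walkSum Y (walk x w)
        = (walkSum Y (walk (walkEnd (x.shift κ) u) w) - walkSum Y (walk (x.shift κ) w)) + (walkSum Y (walk (x.shift κ) w) - walkSum Y (walk x w)) := by abel
    rw [e, ih, h1]
    abel
  | x, (κ, false) :: u => by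
    have ih := walkSum_walkEnd_sub Y w (x.unshift κ) u
    have h1 := walkSum_shift_sub Y κ (x.unshift κ) w
    simp only [walk, walkEnd, walkSum_cons, Bool.false_eq_true, if_false]
    rw [walkEnd_unshift κ x w] at ih
    rw [Site.shift_unshift, walkEnd_unshift] at h1
    have e : walkSum Y (walk (walkEnd (x.unshift κ) u) w) - walkSum Y (walk x w)
        = (walkSum Y (walk (walkEnd (x.unshift κ) u) w) - walkSum Y (walk (x.unshift κ) w)) - (walkSum Y (walk x w) - walkSum Y (walk (x.unshift κ) w)) := by abel
    rw [e, ih, h1]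
    abel

/-- For a CLOSED walk (`walkEnd x w = x`) the connectors cancel: sliding it along `u` changes its sum by minus the swept surface only.
[cite: Balaban1984PropagatorsI, (1.9) p.19] -/
theorem walkSum_walkEnd_sub_of_closed (Y : PBond P j → V) (w u : List (Letter P.d)) (x : Site P j) (hw : walkEnd x w = x) :
    walkSum Y (walk (walkEnd x u) w) - walkSum Y (walk x w)
      = -walkSum (fun t : PBond P j =>
            walkSum (fun b : PBond P j => Y ⟨b.src, b.dir⟩ + Y ⟨b.src.shift b.dir, t.dir⟩ - Y ⟨b.src.shift t.dir, b.dir⟩ - Y ⟨b.src, t.dir⟩) (walk t.src w))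
          (walk x u) := by
  rw [walkSum_walkEnd_sub, hw, sub_self, zero_sub]

/-! ## §4 The plaquette field in `curl 1 Y` letters -/

section Curl

variable [Module ℝ V]

/-- For `μ < κ` the plaquette field of the ribbon IS the route's `curl 1 Y ⟨z, μ, κ⟩`. [cite: Balaban1984PropagatorsI, (1.2) p.18] -/
theorem plaqField_eq_curl_of_lt (Y : PBond P j → V) (z : Site P j) {μ κ : Fin P.d} (h : μ < κ) :
    Y ⟨z, μ⟩ + Y ⟨z.shift μ, κ⟩ - Y ⟨z.shift κ, μ⟩ - Y ⟨z, κ⟩ = curl 1 Y ⟨z, μ, κ, h⟩ := by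
  rw [curl, one_smul]

/-- For `κ < μ` it is MINUS `curl 1 Y ⟨z, κ, μ⟩`. [cite: Balaban1984PropagatorsI, (1.2) p.18] -/
theorem plaqField_eq_neg_curl_of_gt (Y : PBond P j → V) (z : Site P j) {μ κ : Fin P.d} (h : κ < μ) :
    Y ⟨z, μ⟩ + Y ⟨z.shift μ, κ⟩ - Y ⟨z.shift κ, μ⟩ - Y ⟨z, κ⟩ = -curl 1 Y ⟨z, κ, μ, h⟩ := by
  rw [curl, one_smul]
  abel

omit [Module ℝ V] in
/-- For `κ = μ` it vanishes (sliding a walk along its own step direction sweeps no area there). [folklore] -/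
theorem plaqField_self (Y : PBond P j → V) (z : Site P j) (μ : Fin P.d) :
    Y ⟨z, μ⟩ + Y ⟨z.shift μ, μ⟩ - Y ⟨z.shift μ, μ⟩ - Y ⟨z, μ⟩ = 0 := by
  abel

end Curl

end Summit.QuantumFields.YangMills.Theorems.Prop7WalkStokes

end
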